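import Literature.NumberTheory.Weil1982.UnitaryFinTopFormRankOneSanitySplit   -- ★ `valued_two_eq_one_of_not_mem`, `valued_conjLocal_apply_self`, `valued_apply_galInv_of_conjLocal_eq` (+ ★ D1, ★ Cayley window)
import Literature.NumberTheory.Weil1982.UnitaryFinTopFormDualLatticeCompact   -- ★ `transpose_map_localForm`, `isUnit_det_localForm`, `conjLocal_conjLocal`
import Literature.NumberTheory.Weil1982.UnitaryFinTopFormDualLattice          -- ★ `conjLocal_mem_localIntegers`
import Summits.HodgeConjecture.HodgeConjecture.Theorems.K2E5BetaDetIndexCalculus  -- ★ part 1∕3 (p855135): `det_mem_localIntegers`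
import HarnessLib

/-!
# K2 ∕ E5 «TamagawaUnitary», unit F (BETA-GAUGE) — helper `K2E5BetaDetQuasiReflection`: unitary QUASI-REFLECTIONS and an integral anisotropic vector;
# `det` maps `U(H)(𝒪_v)` ONTO the norm-one units and `K_U(2p)` ONTO the norm-one units `≡ 1 (2p)` (`N = 2`, `v ∤ 2`, `H_v ∈ GL₂(𝒪_{E_v})`)

Cell `hodgecm-mathlib` (Track B «K2-LIT»), floor 0, item h413 = `stmt-HodgeConjecture-24833`; tier-1 socket module `Cruxes/H413/Lines/K2_E5_TamagawaUnitary_BetaGauge.lean`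
(K2E5-plan (g0), sha16 11aab11c56dfa296), sockets F4 `sig_K2E5BetaSUGoodPlaceDensity` (p19) ∕ F5 `sig_K2E5BetaGoodPlaceMultiplicative` (p06).  PROOF lane, helper file
(`--supports stmt-HodgeConjecture-24833 --as helper`); author K2E5-p19 (g0).  Part 2∕3 of the GROUP SIDE (G) of the road of record `ρ^{U₂}_v = ρ^{SU}_v·ρ^{U₁}_v`
(part 1∕3 = ★ `K2E5BetaDetIndexCalculus`, p855135).  CONTENT:

* §1 QUASI-REFLECTION ALGEBRA over any commutative ring `R` with an endomorphism `σ` (Mathlib `vecMulVec` API): for a column `e`, a row `s` with `s·e = h`, `h k = 1`, the matrices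
  `r(a) = 1 + (a k)·(e ⊗ s)` satisfy `r(a) r(b) = r(a + b + ab)` (`one_add_smul_vecMulVec_mul`), `det r(a) = 1 + a` (`det_one_add_smul_vecMulVec`), and — when `s = ᵗ(σe) F`, `F` is
  `σ`-hermitian, `σ² = 1`, `σ k = k` — `ᵗσ(r(u−1)) F r(u−1) = F` whenever `σ(u) u = 1` (`transpose_map_reflection_mul_mul`): the classical unitary quasi-reflection
  `x ↦ x + (u − 1) h⁻¹ ⟨e, x⟩ e` of determinant `u` along an anisotropic vector `e` (`⟨e, e⟩ = h ∈ Rˣ`).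
* §2 OVER `E_v = Π_{w ∣ v} L_w`: `σ = c ⊗ 1` commutes with inversion (and preserves integrality, ★ `conjLocal_mem_localIntegers`); packaging `r(u−1)` as an element of `U(H)(L⁺_v)` (★ `cmDatum … |>.Local v`) with
  `mat = r(u−1)`, integral when `e, F, h⁻¹, u` are, and in `K_U(2p)` when `u ≡ 1 (2p)` (`exists_mem_level_det_eq_of_vector`).
* §3 THE ANISOTROPIC INTEGRAL VECTOR for `N = 2`, `v ∤ 2`, `H_v, H_v⁻¹ ∈ M₂(𝒪_{E_v})`: place by place `e_w ∈ {(1,0), (0,1), (1, (H_v)₁₀)}` according as `(H_v)₀₀`, `(H_v)₁₁` or neither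
  is a `w`-unit (then `⟨e,e⟩_w ≡ 2(H_v)₀₁(H_v)₁₀ mod 𝔪_w`, a unit since `|2|_w = 1` and `det H_v ∈ 𝒪_w^×`); the rule is `c ⊗ 1`-equivariant because the diagonal of `H_v` is `c ⊗ 1`-fixed
  (`exists_integral_anisotropic_vector`).  EXPORT: **`exists_mem_level_det_eq`** — every integral `u` with `σ(u) u = 1` is `det (mat g)` for some `g ∈ U(H)(𝒪_v)`, with `g ∈ K_U(2p)`
  if `u = 1 + 2p·t`.

HONEST LABEL: HC_CM is proved only modulo the 7 printed citations (2 remaining named inputs: hLiu418 = stmt-HodgeConjecture-24832,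
h413 = stmt-HodgeConjecture-24833) until rung 0 closes; this helper closes no socket and changes no count.

## References
* [PlatonovRapinchuk1994] V. Platonov, A. Rapinchuk, *Algebraic Groups and Number Theory* (1994) — §2.3 (unitary groups, `det : U → U₁`), §3.3 (congruence subgroups), §3.5.
* [Omeara1963] O. T. O'Meara, *Introduction to quadratic forms*, Grundlehren 117 (1963) — §42 (symmetries `τ_y`), §92:1 (integral unimodular lattices split off unit vectors at `p ∤ 2`).
* [Weil1982] A. Weil, *Adeles and Algebraic Groups*, Progress in Math. 23 (1982) — Ch. II §2.4 p. 22.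
-/

set_option autoImplicit false
set_option linter.dupNamespace false

noncomputable section

namespace Summit.HodgeConjecture.HodgeConjecture.Cruxes.H413.K2E5BetaDetQuasiReflection

open NumberField IsDedekindDomain
open Literature.NumberTheory.Automorphic Literature.NumberTheory.Automorphic.UnitaryGroup
open Literature.NumberTheory.Weil1982.UnitaryFinTopForm
open scoped MatrixGroups Matrix

/-! ## §1 Quasi-reflection algebra over a commutative ring -/

section Algebra

variable {R : Type*} [CommRing R] {n : Type*} [Fintype n] [DecidableEq n]

/-- **`r(a) r(b) = r(a + b + ab)`** for `r(a) = 1 + (a k)·(e ⊗ s)`, `s·e = h`, `h k = 1` (`(e ⊗ s)² = h·(e ⊗ s)`). [cite: Omeara1963, §42] -/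
theorem one_add_smul_vecMulVec_mul (e s : n → R) {h k : R} (hh : s ⬝ᵥ e = h) (hk : h * k = 1) (a b : R) :
    (1 + (a * k) • Matrix.vecMulVec e s) * (1 + (b * k) • Matrix.vecMulVec e s) = 1 + ((a + b + a * b) * k) • Matrix.vecMulVec e s := by
  rw [Matrix.add_mul, Matrix.one_mul, Matrix.mul_add, Matrix.mul_one, Matrix.smul_mul, Matrix.mul_smul, smul_smul, Matrix.vecMulVec_mul_vecMulVec, hh,
    Matrix.vecMulVec_smul, smul_smul, add_assoc, ← add_smul, add_assoc, ← add_smul]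
  congr 2
  linear_combination (a * b * k) * hk

/-- **`det r(a) = 1 + a`** (matrix determinant lemma `det (1 + u ⊗ v) = 1 + v·u`). [cite: Omeara1963, §42] -/
theorem det_one_add_smul_vecMulVec (e s : n → R) {h k : R} (hh : s ⬝ᵥ e = h) (hk : h * k = 1) (a : R) :
    (1 + (a * k) • Matrix.vecMulVec e s).det = 1 + a := by
  rw [← Matrix.smul_vecMulVec, Matrix.vecMulVec_eq Unit, Matrix.det_one_add_replicateCol_mul_replicateRow, dotProduct_smul, hh, smul_eq_mul,
    mul_comm (a * k) h, ← mul_assoc, mul_comm h a, mul_assoc, hk, mul_one]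

omit [Fintype n] in
/-- `ᵗσ(1 + x·(e ⊗ s)) = 1 + σ(x)·(σs ⊗ σe)`. [cite: PlatonovRapinchuk1994, §2.3] -/
theorem transpose_map_one_add_smul_vecMulVec (σ : R →+* R) (e s : n → R) (x : R) :
    ((1 + x • Matrix.vecMulVec e s).map σ)ᵀ = 1 + σ x • Matrix.vecMulVec (σ ∘ s) (σ ∘ e) := by
  ext i j
  simp only [Matrix.transpose_apply, Matrix.map_apply, Matrix.add_apply, Matrix.one_apply, Matrix.smul_apply, Matrix.vecMulVec_apply, smul_eq_mul,
    Function.comp_apply, map_add, map_mul, apply_ite σ, map_one, map_zero, eq_comm (a := j) (b := i)]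
  ring

omit [DecidableEq n] in
/-- For `σ` an involution, `F` `σ`-hermitian (`ᵗ(σF) = F`) and `s = ᵗ(σe)·F`: **`σ ∘ s = F e`**. [cite: PlatonovRapinchuk1994, §2.3] -/
theorem comp_vecMul_eq_mulVec (σ : R →+* R) (hσ : ∀ x, σ (σ x) = x) {F : Matrix n n R} (hF : (F.map σ)ᵀ = F) (e : n → R) :
    σ ∘ ((σ ∘ e) ᵥ* F) = F *ᵥ e := by
  funext j
  have hFij : ∀ i, σ (F i j) = F j i := fun i => by
    have h := congr_fun (congr_fun hF j) i
    rwa [Matrix.transpose_apply, Matrix.map_apply] at h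
  simp only [Function.comp_apply, Matrix.vecMul, Matrix.mulVec, dotProduct, map_sum, map_mul, hσ, hFij]
  exact Finset.sum_congr rfl fun i _ => mul_comm _ _

omit [DecidableEq n] in
/-- … hence **`(σs ⊗ σe)·F = F·(e ⊗ s)`** (both equal `(F e) ⊗ s`). [cite: PlatonovRapinchuk1994, §2.3] -/
theorem vecMulVec_conj_mul_eq (σ : R →+* R) (hσ : ∀ x, σ (σ x) = x) {F : Matrix n n R} (hF : (F.map σ)ᵀ = F) (e : n → R) :
    Matrix.vecMulVec (σ ∘ ((σ ∘ e) ᵥ* F)) (σ ∘ e) * F = F * Matrix.vecMulVec e ((σ ∘ e) ᵥ* F) := by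
  rw [Matrix.vecMulVec_mul, Matrix.mul_vecMulVec, comp_vecMul_eq_mulVec σ hσ hF e]

omit [DecidableEq n] in
/-- … and **`σ(s·e) = s·e`** (the hermitian value `⟨e, e⟩` is `σ`-fixed). [cite: PlatonovRapinchuk1994, §2.3] -/
theorem map_vecMul_dotProduct (σ : R →+* R) (hσ : ∀ x, σ (σ x) = x) {F : Matrix n n R} (hF : (F.map σ)ᵀ = F) (e : n → R) :
    σ (((σ ∘ e) ᵥ* F) ⬝ᵥ e) = ((σ ∘ e) ᵥ* F) ⬝ᵥ e := by
  have h1 : σ (((σ ∘ e) ᵥ* F) ⬝ᵥ e) = (σ ∘ ((σ ∘ e) ᵥ* F)) ⬝ᵥ (σ ∘ e) := by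
    simp only [dotProduct, map_sum, map_mul, Function.comp_apply]
  rw [h1, comp_vecMul_eq_mulVec σ hσ hF e, dotProduct_comm, Matrix.dotProduct_mulVec]

/-- **UNITARITY OF THE QUASI-REFLECTION**: with `s = ᵗ(σe) F`, `h = s·e`, `h k = 1`, `σ k = k` and `σ(u) u = 1`, the matrix `r = 1 + ((u − 1) k)·(e ⊗ s)` satisfies `ᵗ(σ r) F r = F`
(`ᵗσr F r = F + (ā + a + ā a h)·F(e ⊗ s)` with `a = (u−1)k`, `ā = (σu − 1)k`, and `ā + a + ā a h = k(σ(u)u − 1) = 0`). [cite: Omeara1963, §42] [cite: PlatonovRapinchuk1994, §2.3] -/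
theorem transpose_map_reflection_mul_mul (σ : R →+* R) (hσ : ∀ x, σ (σ x) = x) {F : Matrix n n R} (hF : (F.map σ)ᵀ = F) (e : n → R)
    {h k : R} (hh : ((σ ∘ e) ᵥ* F) ⬝ᵥ e = h) (hk : h * k = 1) (hσk : σ k = k) {u : R} (hu : σ u * u = 1) :
    ((1 + ((u - 1) * k) • Matrix.vecMulVec e ((σ ∘ e) ᵥ* F)).map σ)ᵀ * F * (1 + ((u - 1) * k) • Matrix.vecMulVec e ((σ ∘ e) ᵥ* F)) = F := by
  set s : n → R := (σ ∘ e) ᵥ* F with hs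
  set M : Matrix n n R := Matrix.vecMulVec e s with hM
  have hMF : Matrix.vecMulVec (σ ∘ s) (σ ∘ e) * F = F * M := by rw [hM, hs]; exact vecMulVec_conj_mul_eq σ hσ hF e
  have hMM : M * M = h • M := by rw [hM, Matrix.vecMulVec_mul_vecMulVec, hh, Matrix.vecMulVec_smul]
  rw [transpose_map_one_add_smul_vecMulVec, map_mul, map_sub, map_one, hσk]
  -- expand `(1 + ā M†) F (1 + a M)`
  have e1 : (1 + ((σ u - 1) * k) • Matrix.vecMulVec (σ ∘ s) (σ ∘ e)) * F * (1 + ((u - 1) * k) • M) =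
      F + (((σ u - 1) * k) + ((u - 1) * k) + ((σ u - 1) * k) * ((u - 1) * k) * h) • (F * M) := by
    have step1 : (1 + ((σ u - 1) * k) • Matrix.vecMulVec (σ ∘ s) (σ ∘ e)) * F = F + ((σ u - 1) * k) • (F * M) := by
      rw [Matrix.add_mul, Matrix.one_mul, Matrix.smul_mul, hMF]
    have step2 : F * M * M = h • (F * M) := by rw [Matrix.mul_assoc, hMM, Matrix.mul_smul]
    rw [step1]
    simp only [Matrix.add_mul, Matrix.mul_add, Matrix.mul_one, Matrix.mul_smul, Matrix.smul_mul, smul_smul, step2, smul_add]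
    module
  have e2 : ((σ u - 1) * k) + ((u - 1) * k) + ((σ u - 1) * k) * ((u - 1) * k) * h = 0 := by
    linear_combination k * hu + ((σ u - 1) * (u - 1) * k) * hk
  rw [e1, e2, zero_smul, add_zero]

end Algebra

/-! ## §2 Over `E_v`: `σ = c ⊗ 1` vs inversion and integrality; the quasi-reflection as an element of `U(H)(L⁺_v)` -/

section Local

variable (L : Type) [Field L] [NumberField L] [IsCMField L] (N : ℕ) (H : Matrix (Fin N) (Fin N) L) (v : HeightOneSpectrum (𝓞 ↥(maximalRealSubfield L)))

/-- `(c ⊗ 1)(z⁻¹) = ((c ⊗ 1) z)⁻¹` on `E_v = Π_w L_w` (componentwise inversion; each `σ_w` is a field homomorphism). [cite: PlatonovRapinchuk1994, §2.3] -/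
theorem conjLocal_inv (z : LocalRing L v) : conjLocal L (IsCMField.complexConj L) v z⁻¹ = (conjLocal L (IsCMField.complexConj L) v z)⁻¹ := by
  funext w
  rw [conjLocal_apply, Pi.inv_apply, Pi.inv_apply, conjLocal_apply, map_inv₀]

omit [IsCMField L] in
/-- An integral `h ∈ 𝒪_{E_v}` with `|h_w|_w = 1` at every `w` is a unit of `𝒪_{E_v}`: `h⁻¹ ∈ 𝒪_{E_v}` and `h h⁻¹ = 1`. [cite: PlatonovRapinchuk1994, §3.3] -/
theorem inv_mem_localIntegers_of_valued_eq_one {h : LocalRing L v} (hv : ∀ w : PlacesOver L v, Valued.v (h w) = 1) :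
    h⁻¹ ∈ localIntegers L v ∧ h * h⁻¹ = 1 := by
  have h0 : ∀ w : PlacesOver L v, h w ≠ 0 := fun w h0 => by
    have := hv w; rw [h0, map_zero] at this; exact zero_ne_one this
  refine ⟨(mem_localIntegers_iff L v _).2 fun w => (mem_integer_iff_valued_le_one L v w _).2 ?_, funext fun w => ?_⟩
  · rw [Pi.inv_apply, map_inv₀, hv w, inv_one]
  · rw [Pi.mul_apply, Pi.inv_apply, mul_inv_cancel₀ (h0 w), Pi.one_apply]

omit [IsCMField L] in
/-- `e ⊗ s ∈ M_N(𝒪_{E_v})` for integral `e`, `s`. [cite: PlatonovRapinchuk1994, §3.3] -/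
theorem vecMulVec_mem_intMatrices {e s : Fin N → LocalRing L v} (he : ∀ i, e i ∈ localIntegers L v) (hs : ∀ j, s j ∈ localIntegers L v) :
    Matrix.vecMulVec e s ∈ intMatrices L N v :=
  (mem_intMatrices_iff L N v _).2 fun i j => by rw [Matrix.vecMulVec_apply]; exact mul_mem (he i) (hs j)

/-- `s = ᵗ(σe) H_v` is integral for integral `e`, `H_v`. [cite: PlatonovRapinchuk1994, §3.3] -/
theorem vecMul_mem_localIntegers {e : Fin N → LocalRing L v} (he : ∀ i, e i ∈ localIntegers L v) (hF : localForm L N H v ∈ intMatrices L N v) (j : Fin N) :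
    ((conjLocal L (IsCMField.complexConj L) v ∘ e) ᵥ* localForm L N H v) j ∈ localIntegers L v := by
  rw [Matrix.vecMul, dotProduct]
  exact sum_mem fun i _ => mul_mem (conjLocal_mem_localIntegers L v (he i)) ((mem_intMatrices_iff L N v _).1 hF i j)

/-- **THE QUASI-REFLECTION AS AN ELEMENT OF `U(H)(L⁺_v)`** along an integral vector `e` with `⟨e,e⟩ = ᵗ(σe) H_v e` a unit of `𝒪_{E_v}`: for every integral `u` with `σ(u) u = 1` there is
`g ∈ U(H)(𝒪_v)` with `mat g = 1 + ((u−1)⟨e,e⟩⁻¹)·(e ⊗ ᵗ(σe)H_v)`, hence `det (mat g) = u`; and `g ∈ K_U(2p)` if `u = 1 + 2p·t` with `t` integral.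
[cite: Omeara1963, §42] [cite: PlatonovRapinchuk1994, §2.3, §3.3] -/
theorem exists_mem_level_det_eq_of_vector (hherm : (H.map (cmConjRingHom L))ᵀ = H) (hF : localForm L N H v ∈ intMatrices L N v)
    {e : Fin N → LocalRing L v} (he : ∀ i, e i ∈ localIntegers L v)
    (hev : ∀ w : PlacesOver L v, Valued.v ((((conjLocal L (IsCMField.complexConj L) v ∘ e) ᵥ* localForm L N H v) ⬝ᵥ e) w) = 1)
    {u : LocalRing L v} (huO : u ∈ localIntegers L v) (hu : conjLocal L (IsCMField.complexConj L) v u * u = 1) :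
    ∃ g : (cmDatum L N H).Local v, g ∈ cmLocalIntegralLevel L N H v ∧ (mat L N H v g).det = u ∧
      ((∃ t ∈ localIntegers L v, u = 1 + twoP L v * t) → g ∈ levelTwoP L N H v 1) := by
  set σ := conjLocal L (IsCMField.complexConj L) v with hσdef
  set F := localForm L N H v with hFdef
  set s : Fin N → LocalRing L v := (σ ∘ e) ᵥ* F with hs
  set h : LocalRing L v := s ⬝ᵥ e with hh
  set k : LocalRing L v := h⁻¹ with hkdef
  have hσσ : ∀ x, σ (σ x) = x := conjLocal_conjLocal L v
  have hFh : (F.map σ)ᵀ = F := transpose_map_localForm L N H v hherm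
  obtain ⟨hkO, hk⟩ := inv_mem_localIntegers_of_valued_eq_one L v hev
  have hσh : σ h = h := map_vecMul_dotProduct σ hσσ hFh e
  have hσk : σ k = k := by rw [hkdef, conjLocal_inv, hσh]
  have hsO : ∀ j, s j ∈ localIntegers L v := vecMul_mem_localIntegers L N H v he hF
  have hMO : Matrix.vecMulVec e s ∈ intMatrices L N v := vecMulVec_mem_intMatrices L N v he hsO
  have hσuO : σ u ∈ localIntegers L v := conjLocal_mem_localIntegers L v huO
  have hu' : σ (σ u) * σ u = 1 := by rw [hσσ, mul_comm]; exact hu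
  -- the two matrices `r(u − 1)`, `r(σu − 1)` are mutually inverse
  have hmul : ∀ a b : LocalRing L v, (1 + (a * k) • Matrix.vecMulVec e s) * (1 + (b * k) • Matrix.vecMulVec e s) =
      1 + ((a + b + a * b) * k) • Matrix.vecMulVec e s := fun a b => one_add_smul_vecMulVec_mul e s hh.symm hk a b
  have hab : ∀ a b : LocalRing L v, b * a = 1 → (a - 1) + (b - 1) + (a - 1) * (b - 1) = 0 := fun a b hab => by linear_combination hab
  have hinv1 : (1 + ((u - 1) * k) • Matrix.vecMulVec e s) * (1 + ((σ u - 1) * k) • Matrix.vecMulVec e s) = 1 := by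
    rw [hmul, hab u (σ u) hu, zero_mul, zero_smul, add_zero]
  have hinv2 : (1 + ((σ u - 1) * k) • Matrix.vecMulVec e s) * (1 + ((u - 1) * k) • Matrix.vecMulVec e s) = 1 := by
    rw [hmul, hab (σ u) u (by rw [mul_comm]; exact hu), zero_mul, zero_smul, add_zero]
  -- the `GL` element and its membership in `U(H)(L⁺_v)`
  let G : GL (Fin N) (LocalRing L v) := ⟨1 + ((u - 1) * k) • Matrix.vecMulVec e s, 1 + ((σ u - 1) * k) • Matrix.vecMulVec e s, hinv1, hinv2⟩
  have hGmem : G ∈ UnitaryGroup.«local» L (IsCMField.complexConj L) N H v := by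
    rw [UnitaryGroup.«local», mem_unitaryGroupOfForm_iff]
    exact transpose_map_reflection_mul_mul σ hσσ hFh e hh.symm hk hσk hu
  refine ⟨⟨G, hGmem⟩, ?_, ?_, ?_⟩
  · -- integrality of `mat g` and `mat g⁻¹`
    rw [mem_cmLocalIntegralLevel_iff_mat]
    refine ⟨?_, ?_⟩
    · show 1 + ((u - 1) * k) • Matrix.vecMulVec e s ∈ intMatrices L N v
      exact add_mem (one_mem_intMatrices L N v) (smul_mem_intMatrices L N v (mul_mem (sub_mem huO (one_mem _)) hkO) hMO)
    · show 1 + ((σ u - 1) * k) • Matrix.vecMulVec e s ∈ intMatrices L N v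
      exact add_mem (one_mem_intMatrices L N v) (smul_mem_intMatrices L N v (mul_mem (sub_mem hσuO (one_mem _)) hkO) hMO)
  · -- the determinant
    show (1 + ((u - 1) * k) • Matrix.vecMulVec e s).det = u
    rw [det_one_add_smul_vecMulVec e s hh.symm hk, add_sub_cancel]
  · -- level `2p`
    rintro ⟨t, ht, hut⟩
    rw [mem_levelTwoP_one_iff]
    have h2p : σ (twoP L v) = twoP L v := by rw [twoP, map_natCast]
    refine ⟨?_, ?_⟩
    · show 1 + ((u - 1) * k) • Matrix.vecMulVec e s - 1 ∈ twoPIntMatrices L N v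
      rw [add_sub_cancel_left, mem_twoPIntMatrices_iff]
      refine ⟨(t * k) • Matrix.vecMulVec e s, smul_mem_intMatrices L N v (mul_mem ht hkO) hMO, ?_⟩
      rw [smul_smul, hut, add_sub_cancel_left, mul_assoc]
    · show 1 + ((σ u - 1) * k) • Matrix.vecMulVec e s - 1 ∈ twoPIntMatrices L N v
      rw [add_sub_cancel_left, mem_twoPIntMatrices_iff]
      refine ⟨(σ t * k) • Matrix.vecMulVec e s, smul_mem_intMatrices L N v (mul_mem (conjLocal_mem_localIntegers L v ht) hkO) hMO, ?_⟩
      rw [smul_smul, hut, map_add, map_one, map_mul, h2p, add_sub_cancel_left, mul_assoc]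

end Local

/-! ## §3 The anisotropic integral vector (`N = 2`, `v ∤ 2`, `H_v ∈ GL₂(𝒪_{E_v})`) and the export -/

section Vector

variable (L : Type) [Field L] [NumberField L] [IsCMField L] (H : Matrix (Fin 2) (Fin 2) L) (v : HeightOneSpectrum (𝓞 ↥(maximalRealSubfield L)))

omit [IsCMField L] in
/-- Unimodularity place by place: if `H_v, H_v⁻¹ ∈ M₂(𝒪_{E_v})` (and `det H ≠ 0`) then `|det H_v|_w = 1` at every `w ∣ v`. [cite: PlatonovRapinchuk1994, §3.3] -/
theorem valued_det_localForm_eq_one (hdet : H.det ≠ 0) (hF : localForm L 2 H v ∈ intMatrices L 2 v) (hF' : (localForm L 2 H v)⁻¹ ∈ intMatrices L 2 v)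
    (w : PlacesOver L v) : Valued.v ((localForm L 2 H v).det w) = 1 := by
  have h1 : (localForm L 2 H v).det * ((localForm L 2 H v)⁻¹).det = 1 := by
    rw [← Matrix.det_mul, Matrix.mul_nonsing_inv _ (isUnit_det_localForm L 2 H v hdet), Matrix.det_one]
  have hd := (mem_integer_iff_valued_le_one L v w _).1 ((mem_localIntegers_iff L v _).1 (K2E5BetaDetIndexCalculus.det_mem_localIntegers L 2 v hF) w)
  have hd' := (mem_integer_iff_valued_le_one L v w _).1 ((mem_localIntegers_iff L v _).1 (K2E5BetaDetIndexCalculus.det_mem_localIntegers L 2 v hF') w)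
  have hw := congr_fun h1 w
  rw [Pi.mul_apply, Pi.one_apply] at hw
  have hprod : Valued.v ((localForm L 2 H v).det w) * Valued.v (((localForm L 2 H v)⁻¹).det w) = 1 := by rw [← map_mul, hw, map_one]
  refine le_antisymm hd (not_lt.1 fun hlt => ?_)
  have : Valued.v ((localForm L 2 H v).det w) * Valued.v (((localForm L 2 H v)⁻¹).det w) < 1 := mul_lt_one_of_lt_of_le hlt hd'
  rw [hprod] at this
  exact lt_irrefl _ this

/-- **AN INTEGRAL ANISOTROPIC VECTOR**: for `v ∤ 2` and `H_v, H_v⁻¹ ∈ M₂(𝒪_{E_v})` there is an integral `e` with `⟨e,e⟩ = ᵗ(σe) H_v e` a `w`-unit at every `w ∣ v` — place by place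
`e_w = (1,0)`, `(0,1)` or `(1, (H_v)₁₀,w)` according as `(H_v)₀₀`, else `(H_v)₁₁`, else neither is a `w`-unit (then `⟨e,e⟩_w = H₀₀ + 2H₀₁H₁₀ + H₀₁H₁₀H₁₁ ≡ 2H₀₁H₁₀`, a unit); the
rule commutes with `c ⊗ 1` because `(H_v)₀₀`, `(H_v)₁₁` are `c ⊗ 1`-fixed and `(c ⊗ 1)(H_v)₁₀ = (H_v)₀₁`. [cite: Omeara1963, §92:1] [cite: PlatonovRapinchuk1994, §3.3] -/
theorem exists_integral_anisotropic_vector (hherm : (H.map (cmConjRingHom L))ᵀ = H) (hdet : H.det ≠ 0) (h2 : (2 : 𝓞 ↥(maximalRealSubfield L)) ∉ v.asIdeal)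
    (hF : localForm L 2 H v ∈ intMatrices L 2 v) (hF' : (localForm L 2 H v)⁻¹ ∈ intMatrices L 2 v) :
    ∃ e : Fin 2 → LocalRing L v, (∀ i, e i ∈ localIntegers L v) ∧
      ∀ w : PlacesOver L v, Valued.v ((((conjLocal L (IsCMField.complexConj L) v ∘ e) ᵥ* localForm L 2 H v) ⬝ᵥ e) w) = 1 := by
  classical
  set σ := conjLocal L (IsCMField.complexConj L) v with hσdef
  set F := localForm L 2 H v with hFdef
  have hFh : (F.map σ)ᵀ = F := transpose_map_localForm L 2 H v hherm
  have hFij : ∀ i j, σ (F i j) = F j i := fun i j => by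
    have h := congr_fun (congr_fun hFh j) i
    rwa [Matrix.transpose_apply, Matrix.map_apply] at h
  have hFint : ∀ i j (w : PlacesOver L v), Valued.v (F i j w) ≤ 1 := fun i j w =>
    (mem_integer_iff_valued_le_one L v w _).1 ((mem_localIntegers_iff L v _).1 ((mem_intMatrices_iff L 2 v _).1 hF i j) w)
  -- the `c ⊗ 1`-fixed diagonal: unit-ness of `H₀₀`, `H₁₁` is the same at `w` and at `c⁻¹ w`
  have hdiag : ∀ i (w : PlacesOver L v), Valued.v (F i i (PlacesOver.galInv (IsCMField.complexConj L) w)) = Valued.v (F i i w) := fun i w =>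
    valued_apply_galInv_of_conjLocal_eq L v w (hFij i i)
  -- the vector
  let e : Fin 2 → LocalRing L v := fun i w =>
    if Valued.v (F 0 0 w) = 1 then (if i = 0 then 1 else 0)
    else if Valued.v (F 1 1 w) = 1 then (if i = 0 then 0 else 1)
    else (if i = 0 then 1 else F 1 0 w)
  have he0 : ∀ w, e 0 w = if Valued.v (F 0 0 w) = 1 then 1 else if Valued.v (F 1 1 w) = 1 then 0 else 1 := fun w => by
    simp only [e, if_true]
  have he1 : ∀ w, e 1 w = if Valued.v (F 0 0 w) = 1 then 0 else if Valued.v (F 1 1 w) = 1 then 1 else F 1 0 w := fun w => by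
    simp only [e, one_ne_zero, if_false]
  -- its conjugate, read at `w`
  have hσe0 : ∀ w, σ (e 0) w = if Valued.v (F 0 0 w) = 1 then 1 else if Valued.v (F 1 1 w) = 1 then 0 else 1 := fun w => by
    rw [hσdef, conjLocal_apply, he0, hdiag 0 w, hdiag 1 w]
    split_ifs <;> simp
  have hσe1 : ∀ w, σ (e 1) w = if Valued.v (F 0 0 w) = 1 then 0 else if Valued.v (F 1 1 w) = 1 then 1 else F 0 1 w := fun w => by
    have h10 : σ (F 1 0) w = F 0 1 w := by rw [hFij 1 0]
    rw [hσdef, conjLocal_apply] at h10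
    rw [hσdef, conjLocal_apply, he1, hdiag 0 w, hdiag 1 w]
    split_ifs <;> simp [h10]
  refine ⟨e, fun i => ?_, fun w => ?_⟩
  · -- integrality
    refine (mem_localIntegers_iff L v _).2 fun w => (mem_integer_iff_valued_le_one L v w _).2 ?_
    fin_cases i
    · show Valued.v (e 0 w) ≤ 1
      rw [he0]; split_ifs <;> simp
    · show Valued.v (e 1 w) ≤ 1
      rw [he1]; split_ifs
      · simp
      · simp
      · exact hFint 1 0 w
  · -- the value `⟨e,e⟩_w`
    have hexp : (((σ ∘ e) ᵥ* F) ⬝ᵥ e) w = σ (e 0) w * F 0 0 w * e 0 w + σ (e 1) w * F 1 0 w * e 0 w + (σ (e 0) w * F 0 1 w * e 1 w + σ (e 1) w * F 1 1 w * e 1 w) := by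
      simp only [dotProduct, Matrix.vecMul, Fin.sum_univ_two, Function.comp_apply, Finset.sum_apply, Pi.add_apply, Pi.mul_apply]
      ring
    rw [hexp, hσe0, hσe1, he0, he1]
    have hv2 : Valued.v (2 : w.1.adicCompletion L) = 1 := valued_two_eq_one_of_not_mem L v w h2
    have hdetw : Valued.v (F 0 0 w * F 1 1 w - F 0 1 w * F 1 0 w) = 1 := by
      have h := valued_det_localForm_eq_one L H v hdet hF hF' w
      rwa [Matrix.det_fin_two, Pi.sub_apply, Pi.mul_apply, Pi.mul_apply] at h
    by_cases hA : Valued.v (F 0 0 w) = 1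
    · simp only [hA, if_true, one_mul, mul_one, mul_zero, zero_mul, add_zero]
    · by_cases hB : Valued.v (F 1 1 w) = 1
      · simp only [hA, hB, if_true, if_false, one_mul, mul_one, mul_zero, zero_mul, zero_add]
      · simp only [hA, hB, if_false, one_mul, mul_one]
        -- branch 3: `H₀₀ + H₀₁H₁₀ + (H₀₁H₁₀ + H₀₁H₁₁H₁₀)`, with `|H₀₀|, |H₁₁| < 1`, `|H₀₁H₁₀| = 1 = |2|`
        have hA' : Valued.v (F 0 0 w) < 1 := lt_of_le_of_ne (hFint 0 0 w) hA
        have hB' : Valued.v (F 1 1 w) < 1 := lt_of_le_of_ne (hFint 1 1 w) hB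
        have hbc : Valued.v (F 0 1 w * F 1 0 w) = 1 := by
          have e1 : F 0 1 w * F 1 0 w = F 0 0 w * F 1 1 w - (F 0 0 w * F 1 1 w - F 0 1 w * F 1 0 w) := by ring
          have hlt : Valued.v (F 0 0 w * F 1 1 w) < Valued.v (F 0 0 w * F 1 1 w - F 0 1 w * F 1 0 w) := by
            rw [hdetw, map_mul]; exact mul_lt_one_of_lt_of_le hA' (hFint 1 1 w)
          rw [e1, Valuation.map_sub_eq_of_lt_right _ hlt, hdetw]
        have e2 : F 0 0 w + F 0 1 w * F 1 0 w + (F 0 1 w * F 1 0 w + F 0 1 w * F 1 1 w * F 1 0 w) =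
            F 0 0 w + (2 * (F 0 1 w * F 1 0 w) + F 0 1 w * F 1 0 w * F 1 1 w) := by ring
        have h2bc : Valued.v (2 * (F 0 1 w * F 1 0 w)) = 1 := by rw [map_mul, hv2, hbc, one_mul]
        have hbcd : Valued.v (F 0 1 w * F 1 0 w * F 1 1 w) < Valued.v (2 * (F 0 1 w * F 1 0 w)) := by
          rw [h2bc, map_mul, hbc, one_mul]; exact hB'
        have hmid : Valued.v (2 * (F 0 1 w * F 1 0 w) + F 0 1 w * F 1 0 w * F 1 1 w) = 1 := by
          rw [Valuation.map_add_eq_of_lt_left _ hbcd, h2bc]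
        have hlast : Valued.v (F 0 0 w) < Valued.v (2 * (F 0 1 w * F 1 0 w) + F 0 1 w * F 1 0 w * F 1 1 w) := by rw [hmid]; exact hA'
        rw [e2, Valuation.map_add_eq_of_lt_right _ hlast, hmid]

/-- **EXPORT — `det` IS ONTO THE NORM-ONE UNITS, LEVEL BY LEVEL** (`N = 2`, `v ∤ 2`, `H` hermitian with `det H ≠ 0`, `H_v, H_v⁻¹ ∈ M₂(𝒪_{E_v})`): every integral `u ∈ 𝒪_{E_v}` with
`(c ⊗ 1)(u)·u = 1` is `det (mat g)` for some `g ∈ U(H)(𝒪_v)`, and `g` may be taken in `K_U(2p)` when `u = 1 + 2p·t` (`t` integral) — the quasi-reflection of §2 along the vector of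
`exists_integral_anisotropic_vector`. [cite: Omeara1963, §42, §92:1] [cite: PlatonovRapinchuk1994, §2.3, §3.3] -/
theorem exists_mem_level_det_eq (hherm : (H.map (cmConjRingHom L))ᵀ = H) (hdet : H.det ≠ 0) (h2 : (2 : 𝓞 ↥(maximalRealSubfield L)) ∉ v.asIdeal)
    (hF : localForm L 2 H v ∈ intMatrices L 2 v) (hF' : (localForm L 2 H v)⁻¹ ∈ intMatrices L 2 v)
    {u : LocalRing L v} (huO : u ∈ localIntegers L v) (hu : conjLocal L (IsCMField.complexConj L) v u * u = 1) :
    ∃ g : (cmDatum L 2 H).Local v, g ∈ cmLocalIntegralLevel L 2 H v ∧ (mat L 2 H v g).det = u ∧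
      ((∃ t ∈ localIntegers L v, u = 1 + twoP L v * t) → g ∈ levelTwoP L 2 H v 1) := by
  obtain ⟨e, he, hev⟩ := exists_integral_anisotropic_vector L H v hherm hdet h2 hF hF'
  exact exists_mem_level_det_eq_of_vector L 2 H v hherm hF he hev huO hu

end Vector

end Summit.HodgeConjecture.HodgeConjecture.Cruxes.H413.K2E5BetaDetQuasiReflection

end
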